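import Literature.Topology.FourManifolds.SmoothSchoenfliesFiveLeTheta
import Literature.Topology.FourManifolds.SmaleHomologySpheresFiveSixTheta
import Literature.Topology.FourManifolds.HCobordismWhitneyIsotopyProofs
import HarnessLib

/-!
# The smooth Schoenflies theorem in dimensions `≥ 5`: the residue is `{Milnor Thm. 7.6, Θ₅ = Θ₆ = 0}`

Topic `Literature/Topology/FourManifolds`; eighth companion of the named fact
`Literature.Topology.FourManifolds.exists_diffeomorph_image_eq_sphereEquator_of_five_le`
(`SliceKnots.lean`; Milnor, *Lectures on the h-cobordism theorem* (1965), §9, Prop. D), written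
for the fact-decomposition pass of 2026-08-16 (no new named fact; theorems only).

`SmoothSchoenfliesFiveLeTheta.lean` closed the fact modulo the two remaining leaves of Milnor's
Thm. 9.1 — the Basis Theorem 7.6 on a slab (`Cobordism.Milnor1965_basisTheorem_slab`) and Thm. 6.6
with its Remark (`Milnor1965_whitney_isotopy`) — and `Subsingleton (HomotopySphereClass 5)`
(`Θ₅ = 0`). Since then Thm. 6.6 has been PROVED (`Milnor1965_whitney_isotopy_holds`,
`HCobordismWhitneyIsotopyProofs.lean`), and `Θ₅ = 0` is itself a consequence of Thm. 9.1 and the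
Kervaire–Milnor/Wall theorem quoted by Milnor on p. 111
(`Milnor1965_boundsContractible_of_homologySphere`, a named fact of the tree) through the
diffeomorphism clause of Prop. B (`nonempty_diffeomorph_sphere_of_homologySphere_five_six_of_two_hubs'`,
`subsingleton_homotopySphereClass_of_nonempty_diffeomorph_sphere_of_homologySphere_five_six`,
`SmaleHomologySpheresFiveSixTheta.lean`). This file records the resulting shape of the discharge
over the tree's NAMED facts only:

* `exists_diffeomorph_image_eq_sphereEquator_of_five_le_of_basisTheorem_of_boundsContractible` —
  the fact from `Cobordism.Milnor1965_basisTheorem_slab.{0}` and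
  `Milnor1965_boundsContractible_of_homologySphere.{0}` alone; the discharge
  `exists_diffeomorph_image_eq_sphereEquator_of_five_le_holds` is this theorem applied to their
  `_holds` once they land (dimensions `≥ 6` need only the first,
  `exists_diffeomorph_image_eq_sphereEquator_of_six_le_of_two_leaves`).

## References

* J. Milnor, *Lectures on the h-cobordism theorem* (1965), §9: Thm. 9.1 (p. 107), Prop. B
  (p. 109), p. 111, Prop. D (p. 112); Thm. 7.6; Thm. 6.6. [MilnorHCobordism1965]
* M. Kervaire, J. Milnor, *Groups of homotopy spheres I*, Ann. of Math. (2) 77 (1963), 504–537,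
  §1 and table p. 504. [KervaireMilnorAnnals1963]
* S. Smale, *On the structure of manifolds*, Amer. J. Math. 84 (1962), Thm. 1.1. [Smale1962]
-/

open scoped Manifold ContDiff Topology

noncomputable section

namespace Literature.Topology.FourManifolds

/-- **The smooth Schoenflies theorem in dimensions `n + 1 ≥ 5` from Milnor's Basis Theorem 7.6
on a slab and the Kervaire–Milnor/Wall theorem for `n = 5, 6`** (the exact residue of the named
fact over the tree's named facts, 2026-08-16): Thm. 7.6 with the proved Thm. 6.6
(`Milnor1965_whitney_isotopy_holds`) gives Thm. 9.1
(`isTrivial_of_isHCobordism_of_five_le_of_two_leaves`); Thm. 9.1 with the Kervaire–Milnor/Wall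
hypothesis gives the diffeomorphism clause of Prop. B, hence `Θ₅ = 0`; and
`exists_diffeomorph_image_eq_sphereEquator_of_five_le_of_hcobordism_of_subsingleton` concludes
(Milnor §9: Prop. D from A) and C(1), C(1) from B)).
[cite: MilnorHCobordism1965, §9 Thm. 9.1, Prop. B, Prop. D (pp. 107–112), Thm. 7.6, Thm. 6.6]
[cite: KervaireMilnorAnnals1963, §1 and table p. 504] [cite: Smale1962, Thm. 1.1] -/
theorem exists_diffeomorph_image_eq_sphereEquator_of_five_le_of_basisTheorem_of_boundsContractible
    (hB : Cobordism.Milnor1965_basisTheorem_slab.{0})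
    (hKM : Milnor1965_boundsContractible_of_homologySphere.{0}) :
    exists_diffeomorph_image_eq_sphereEquator_of_five_le :=
  exists_diffeomorph_image_eq_sphereEquator_of_five_le_of_hcobordism_of_subsingleton
    (isTrivial_of_isHCobordism_of_five_le_of_two_leaves hB Milnor1965_whitney_isotopy_holds)
    (subsingleton_homotopySphereClass_of_nonempty_diffeomorph_sphere_of_homologySphere_five_six
      (nonempty_diffeomorph_sphere_of_homologySphere_five_six_of_two_hubs'.{0}
        (isTrivial_of_isHCobordism_of_five_le_of_two_leaves hB Milnor1965_whitney_isotopy_holds)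
        hKM)).1

end Literature.Topology.FourManifolds

end
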